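import Mathlib.LinearAlgebra.Basis.VectorSpace
import Mathlib.Order.CompactlyGenerated.Basic
import Literature.AlgebraicGeometry.Motives.MixedHodgeStructureSplitting
import HarnessLib

/-!
# Morphisms of mixed Hodge structures are strict (discharge of `Hom.strict`)

This file proves the named fact `Literature.AlgebraicGeometry.Motives.MixedHodgeStructure.Hom.strict`
of `MixedHodgeStructure.lean`: every morphism `f : H₁ → H₂` of mixed `ℚ`-Hodge structures is
strictly compatible with the weight filtrations (`f(W_k V) = W_k V' ∩ im f`, over `ℚ`) and with
the Hodge filtrations (`f_ℂ(F^p V_ℂ) = F^p V'_ℂ ∩ im f_ℂ`) — Deligne, *Théorie de Hodge II*,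
Thm. 2.3.5 (iii); Cattani–El Zein–Griffiths–Lê, *Hodge Theory*, Cor. 3.2.21 (i). The proof is
Deligne's, through the splitting `I^{p,q}` (`MixedHodgeStructureSplitting.lean`): a morphism maps
`I^{p,q}(H₁)` into `I^{p,q}(H₂)`; on each weight level `W_n = (⊕_p I^{p,n-p}) ⊕ W_{n-1}` with
`F^p ∩ W_n ⊆ (⊕_{i ≥ p} I^{i,n-i}) + W_{n-1}`, so comparing the `I`-components of `f_ℂ x` kills the
components of type `(a, n-a)`, `a < p`, and an induction on the weight level produces a
preimage in `F^p` (resp. in `W_k`). Strictness for `W` over `ℚ` follows from the statement over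
`ℂ` by faithful flatness of `ℂ` over `ℚ` (a `ℚ`-linear retraction `ℂ → ℚ`).

## Main results

* `MixedHodgeStructure.Hom.map_F_eq` — `f_ℂ(F^p) = F^p ∩ im f_ℂ`;
* `MixedHodgeStructure.Hom.map_baseChange_W_eq` — `f_ℂ(W_{k,ℂ}) = W_{k,ℂ} ∩ im f_ℂ`;
* `MixedHodgeStructure.Hom.map_W_eq` — `f(W_k) = W_k ∩ im f` (over `ℚ`);
* `MixedHodgeStructure.Hom.isStrict` and `MixedHodgeStructure.Hom.strict_holds : Hom.strict`.

## References

* [DeligneHodgeII1971] P. Deligne, Théorie de Hodge II, Publ. Math. IHÉS 40 (1971), Thm. 1.2.10,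
  Thm. 2.3.5 (iii).
* [CattaniElZeinGriffithsLe2014] E. Cattani et al. (eds.), Hodge Theory (2014), Prop. 3.2.19,
  Lemma 3.2.20, Cor. 3.2.21 (i) (pp. 159–161).
-/

open scoped TensorProduct

noncomputable section

namespace Literature.AlgebraicGeometry.Motives

namespace MixedHodgeStructure

universe u v

variable {V : Type u} [AddCommGroup V] [Module ℚ V]
variable {V' : Type v} [AddCommGroup V'] [Module ℚ V']

/-! ### Rationality: descent of subspaces from `ℂ` to `ℚ` -/

/-- Base change commutes with images: `f_ℂ(P_ℂ) = (f P)_ℂ`. [folklore] -/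
theorem map_baseChange_baseChange (f : V →ₗ[ℚ] V') (P : Submodule ℚ V) :
    (P.baseChange ℂ).map (f.baseChange ℂ) = (P.map f).baseChange ℂ := by
  rw [Submodule.baseChange, LinearMap.range_eq_map, ← Submodule.map_comp,
    ← LinearMap.baseChange_comp, ← LinearMap.range_eq_map, range_baseChange, LinearMap.range_comp,
    Submodule.range_subtype]

/-- **`ℚ`-rationality of base-changed subspaces** (faithful flatness of `ℂ` over `ℚ`): if
`1 ⊗ x ∈ P_ℂ` then `x ∈ P`. Proof: apply `ρ ⊗ id : ℂ ⊗ V → V` for a `ℚ`-linear retraction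
`ρ : ℂ → ℚ` of the inclusion. [folklore] -/
theorem mem_of_one_tmul_mem_baseChange (P : Submodule ℚ V) {x : V}
    (hx : (1 : ℂ) ⊗ₜ[ℚ] x ∈ P.baseChange ℂ) : x ∈ P := by
  obtain ⟨ρ, hρ⟩ := (Algebra.linearMap ℚ ℂ).exists_leftInverse_of_injective
    (LinearMap.ker_eq_bot.2 (algebraMap ℚ ℂ).injective)
  let θ : ℂ ⊗[ℚ] V →ₗ[ℚ] V := (TensorProduct.lid ℚ V : ℚ ⊗[ℚ] V →ₗ[ℚ] V) ∘ₗ ρ.rTensor V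
  have hθ : ∀ (c : ℂ) (v : V), θ (c ⊗ₜ v) = ρ c • v := fun c v => by simp [θ]
  have hθ1 : θ ((1 : ℂ) ⊗ₜ x) = x := by
    rw [hθ]
    have : ρ (Algebra.linearMap ℚ ℂ 1) = 1 := LinearMap.congr_fun hρ 1
    rw [Algebra.linearMap_apply, map_one] at this
    rw [this, one_smul]
  have hθP : ∀ z : ℂ ⊗[ℚ] P, θ (P.subtype.baseChange ℂ z) ∈ P := by
    intro z
    induction z using TensorProduct.induction_on with
    | zero => simp
    | tmul c p =>
      rw [LinearMap.baseChange_tmul, hθ]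
      exact P.smul_mem _ p.2
    | add a b ha hb =>
      rw [map_add, map_add]
      exact P.add_mem ha hb
  obtain ⟨z, hz⟩ := hx
  rw [← hθ1, ← hz]
  exact hθP z

/-! ### Strictness -/

namespace Hom

variable {H₁ : MixedHodgeStructure V} {H₂ : MixedHodgeStructure V'}

/-- A morphism maps `Σ_{i ∈ s} I^{i,m-i}(H₁)` into `Σ_{i ∈ s} I^{i,m-i}(H₂)`. [folklore] -/
theorem map_biSup_deligneI_le (f : Hom H₁ H₂) (s : Set ℤ) (m : ℤ) :
    (⨆ i ∈ s, H₁.deligneI i (m - i)).map (f.toLinearMap.baseChange ℂ) ≤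
      ⨆ i ∈ s, H₂.deligneI i (m - i) := by
  rw [Submodule.map_iSup]
  refine iSup_mono fun i => ?_
  rw [Submodule.map_iSup]
  exact iSup_mono fun _ => f.map_deligneI_le i (m - i)

/-- A morphism maps `Σ_i I^{i,m-i}(H₁)` into `Σ_i I^{i,m-i}(H₂)`. [folklore] -/
theorem map_iSup_deligneI_le (f : Hom H₁ H₂) (m : ℤ) :
    (⨆ i, H₁.deligneI i (m - i)).map (f.toLinearMap.baseChange ℂ) ≤ ⨆ i, H₂.deligneI i (m - i) := by
  rw [Submodule.map_iSup]
  exact iSup_mono fun i => f.map_deligneI_le i (m - i)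

/-- `F^p ∩ W_n ⊆ (Σ_{i ≥ p} I^{i,n-i}) + W_{n-1}`, with the sum indexed by `Set.Ici p`. [folklore] -/
theorem _root_.Literature.AlgebraicGeometry.Motives.MixedHodgeStructure.F_inf_W_le_biSup
    (H : MixedHodgeStructure V) (p n : ℤ) :
    H.F p ⊓ (H.W n).baseChange ℂ ≤
      (⨆ i ∈ Set.Ici p, H.deligneI i (n - i)) ⊔ (H.W (n - 1)).baseChange ℂ := by
  convert H.F_inf_W_le p n using 2
  rw [iSup_subtype']
  rfl

/-- `Σ_{i ≥ p} I^{i,n-i} ⊆ F^p`. [folklore] -/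
theorem _root_.Literature.AlgebraicGeometry.Motives.MixedHodgeStructure.biSup_deligneI_le_F
    (H : MixedHodgeStructure V) (p n : ℤ) :
    ⨆ i ∈ Set.Ici p, H.deligneI i (n - i) ≤ H.F p :=
  iSup₂_le fun i hi => (H.deligneI_le_F i (n - i)).trans (H.antitone_F (Set.mem_Ici.1 hi))

/-- **Strictness for `F`, inductive form**: every `x ∈ W_{b+k,ℂ}` (`W_b = 0`) with
`f_ℂ x ∈ F^p V'_ℂ` has the same image as some `x' ∈ F^p V_ℂ` (Deligne, Hodge II, 2.3.5 (iii);
Cattani et al., §3.2.2.5: compare `I`-components and induct on the weight). [folklore] -/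
theorem exists_mem_F_apply_eq_aux (f : Hom H₁ H₂) (p b : ℤ) (hb : H₁.W b = ⊥) (k : ℕ) :
    ∀ x ∈ (H₁.W (b + k)).baseChange ℂ, f.toLinearMap.baseChange ℂ x ∈ H₂.F p →
      ∃ x' ∈ H₁.F p, f.toLinearMap.baseChange ℂ x' = f.toLinearMap.baseChange ℂ x := by
  set fC := f.toLinearMap.baseChange ℂ with hfC
  induction k with
  | zero =>
    intro x hx _
    rw [Nat.cast_zero, add_zero, hb, Submodule.baseChange_bot, Submodule.mem_bot] at hx
    exact ⟨0, Submodule.zero_mem _, by rw [hx]⟩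
  | succ k ih =>
    intro x hxW hxF
    set m : ℤ := b + (k + 1 : ℕ) with hm
    have hm1 : m - 1 = b + k := by rw [hm]; push_cast; ring
    -- decompose `x = (jp + jm) + w` along `W_m = (Σ_a I^{a,m-a}) + W_{m-1}`, `a ≥ p` / `a < p`
    have hx' := hxW
    rw [H₁.W_eq_iSup_deligneI_sup m] at hx'
    obtain ⟨j, hj, w, hw, rfl⟩ := Submodule.mem_sup.1 hx'
    rw [iSup_split _ (· ∈ Set.Ici p)] at hj
    obtain ⟨jp, hjp, jm, hjm, rfl⟩ := Submodule.mem_sup.1 hj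
    have hjpF : jp ∈ H₁.F p := H₁.biSup_deligneI_le_F p m hjp
    have hfjp : fC jp ∈ ⨆ i ∈ Set.Ici p, H₂.deligneI i (m - i) :=
      f.map_biSup_deligneI_le _ m ⟨jp, hjp, rfl⟩
    have hfjm : fC jm ∈ ⨆ i ∈ (Set.Ici p)ᶜ, H₂.deligneI i (m - i) :=
      f.map_biSup_deligneI_le _ m ⟨jm, hjm, rfl⟩
    have hfw : fC w ∈ (H₂.W (m - 1)).baseChange ℂ := f.map_baseChange_W_le (m - 1) ⟨w, hw, rfl⟩
    -- decompose `f x ∈ F^p ∩ W_m` along `(Σ_{a ≥ p} I^{a,m-a}) + W_{m-1}` in `H₂`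
    have hy : fC (jp + jm + w) ∈ (⨆ i ∈ Set.Ici p, H₂.deligneI i (m - i)) ⊔
        (H₂.W (m - 1)).baseChange ℂ :=
      H₂.F_inf_W_le_biSup p m ⟨hxF, f.map_baseChange_W_le m ⟨_, hxW, rfl⟩⟩
    obtain ⟨yp, hyp, w', hw', hyeq⟩ := Submodule.mem_sup.1 hy
    -- the component of `f x` in `Σ_{a < p} I^{a,m-a}` vanishes
    have hle₁ : (⨆ i ∈ Set.Ici p, H₂.deligneI i (m - i)) ≤ ⨆ i, H₂.deligneI i (m - i) :=
      iSup₂_le fun i _ => le_iSup (fun i => H₂.deligneI i (m - i)) i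
    have hle₂ : (⨆ i ∈ (Set.Ici p)ᶜ, H₂.deligneI i (m - i)) ≤ ⨆ i, H₂.deligneI i (m - i) :=
      iSup₂_le fun i _ => le_iSup (fun i => H₂.deligneI i (m - i)) i
    have hd : fC jm - (yp - fC jp) = 0 := by
      have h1 : fC jm - (yp - fC jp) ∈ ⨆ i, H₂.deligneI i (m - i) :=
        Submodule.sub_mem _ (hle₂ hfjm) (Submodule.sub_mem _ (hle₁ hyp) (hle₁ hfjp))
      have h2 : fC jm - (yp - fC jp) ∈ (H₂.W (m - 1)).baseChange ℂ := by
        have he : fC jm - (yp - fC jp) = w' - fC w := by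
          have h' : yp + w' = fC jp + fC jm + fC w := by rw [hyeq, map_add, map_add]
          have h'' : fC jm = yp + w' - fC jp - fC w := by rw [h']; abel
          rw [h'']
          abel
        rw [he]
        exact Submodule.sub_mem _ hw' hfw
      have : fC jm - (yp - fC jp) ∈ (⨆ i, H₂.deligneI i (m - i)) ⊓ (H₂.W (m - 1)).baseChange ℂ :=
        ⟨h1, h2⟩
      rwa [H₂.iSup_deligneI_inf_W_pred_eq_bot m, Submodule.mem_bot] at this
    have hjm0 : fC jm = 0 := by
      have hmem : fC jm ∈ (⨆ i ∈ Set.Ici p, H₂.deligneI i (m - i)) ⊓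
          ⨆ i ∈ (Set.Ici p)ᶜ, H₂.deligneI i (m - i) := by
        refine ⟨?_, hfjm⟩
        rw [sub_eq_zero] at hd
        rw [hd]
        exact Submodule.sub_mem _ hyp hfjp
      have hdis := (H₂.iSupIndep_deligneI m).disjoint_biSup_biSup
        (disjoint_compl_right (a := Set.Ici p))
      rw [disjoint_iff] at hdis
      rwa [hdis, Submodule.mem_bot] at hmem
    -- `f w ∈ F^p`, induct
    have hfwF : fC w ∈ H₂.F p := by
      have he : fC w = fC (jp + jm + w) - fC jp := by rw [map_add, map_add, hjm0]; abel
      rw [he]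
      exact Submodule.sub_mem _ hxF (f.map_F_le p ⟨jp, hjpF, rfl⟩)
    obtain ⟨w₁, hw₁F, hw₁⟩ := ih w (by rwa [← hm1]) hfwF
    refine ⟨jp + w₁, (H₁.F p).add_mem hjpF hw₁F, ?_⟩
    rw [map_add, hw₁, map_add, map_add, hjm0, add_zero]

/-- **Morphisms of mixed Hodge structures are strict for the Hodge filtration**:
`f_ℂ(F^p V_ℂ) = F^p V'_ℂ ∩ im f_ℂ` (Deligne, *Théorie de Hodge II*, Thm. 2.3.5 (iii);
Cattani–El Zein–Griffiths–Lê, Cor. 3.2.21 (i)). [cite: DeligneHodgeII1971, Thm. 2.3.5 (iii)] -/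
theorem map_F_eq (f : Hom H₁ H₂) (p : ℤ) :
    (H₁.F p).map (f.toLinearMap.baseChange ℂ) =
      H₂.F p ⊓ LinearMap.range (f.toLinearMap.baseChange ℂ) := by
  refine le_antisymm (le_inf (f.map_F_le p) LinearMap.map_le_range) ?_
  rintro _ ⟨hyF, x, rfl⟩
  obtain ⟨b, hb⟩ := H₁.exists_W_eq_bot
  obtain ⟨t, ht⟩ := H₁.exists_W_eq_top
  have hxW : x ∈ (H₁.W (b + ((t - b).toNat : ℕ))).baseChange ℂ := by
    have htop : H₁.W (b + ((t - b).toNat : ℕ)) = ⊤ := by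
      rcases le_or_gt b t with h | h
      · rw [Int.toNat_of_nonneg (by omega), add_sub_cancel, ht]
      · exact eq_top_iff.2 (ht ▸ H₁.monotone_W (by omega))
    rw [htop, Submodule.baseChange_top]
    trivial
  obtain ⟨x', hx', he⟩ := f.exists_mem_F_apply_eq_aux p b hb _ x hxW hyF
  exact ⟨x', hx', he⟩

/-- **Strictness for `W` over `ℂ`, inductive form**: every `x ∈ W_{m,ℂ}` with `f_ℂ x ∈ W_{k,ℂ}`
has the same image as some `x' ∈ W_{k,ℂ}`. [folklore] -/
theorem exists_mem_W_apply_eq_aux (f : Hom H₁ H₂) (k b : ℤ) (hb : H₁.W b = ⊥) (l : ℕ) :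
    ∀ x ∈ (H₁.W (b + l)).baseChange ℂ, f.toLinearMap.baseChange ℂ x ∈ (H₂.W k).baseChange ℂ →
      ∃ x' ∈ (H₁.W k).baseChange ℂ,
        f.toLinearMap.baseChange ℂ x' = f.toLinearMap.baseChange ℂ x := by
  set fC := f.toLinearMap.baseChange ℂ with hfC
  induction l with
  | zero =>
    intro x hx _
    rw [Nat.cast_zero, add_zero, hb, Submodule.baseChange_bot, Submodule.mem_bot] at hx
    exact ⟨0, Submodule.zero_mem _, by rw [hx]⟩
  | succ l ih =>
    intro x hxW hxk
    set m : ℤ := b + (l + 1 : ℕ) with hm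
    have hm1 : m - 1 = b + l := by rw [hm]; push_cast; ring
    rcases le_or_gt m k with hmk | hmk
    · exact ⟨x, H₁.baseChange_W_mono hmk hxW, rfl⟩
    · have hx' := hxW
      rw [H₁.W_eq_iSup_deligneI_sup m] at hx'
      obtain ⟨j, hj, w, hw, rfl⟩ := Submodule.mem_sup.1 hx'
      have hfw : fC w ∈ (H₂.W (m - 1)).baseChange ℂ := f.map_baseChange_W_le (m - 1) ⟨w, hw, rfl⟩
      have hj0 : fC j = 0 := by
        have h1 : fC j ∈ ⨆ i, H₂.deligneI i (m - i) := f.map_iSup_deligneI_le m ⟨j, hj, rfl⟩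
        have h2 : fC j ∈ (H₂.W (m - 1)).baseChange ℂ := by
          have he : fC j = fC (j + w) - fC w := by rw [map_add]; abel
          rw [he]
          exact Submodule.sub_mem _ (H₂.baseChange_W_mono (by omega) hxk) hfw
        have : fC j ∈ (⨆ i, H₂.deligneI i (m - i)) ⊓ (H₂.W (m - 1)).baseChange ℂ := ⟨h1, h2⟩
        rwa [H₂.iSup_deligneI_inf_W_pred_eq_bot m, Submodule.mem_bot] at this
      have hfwk : fC w ∈ (H₂.W k).baseChange ℂ := by
        have he : fC w = fC (j + w) := by rw [map_add, hj0, zero_add]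
        rw [he]
        exact hxk
      obtain ⟨w₁, hw₁, he⟩ := ih w (by rwa [← hm1]) hfwk
      exact ⟨w₁, hw₁, by rw [he, map_add, hj0, zero_add]⟩

/-- **Strictness for `W` over `ℂ`**: `f_ℂ(W_{k,ℂ}) = W_{k,ℂ} ∩ im f_ℂ`. [folklore] -/
theorem map_baseChange_W_eq (f : Hom H₁ H₂) (k : ℤ) :
    ((H₁.W k).baseChange ℂ).map (f.toLinearMap.baseChange ℂ) =
      (H₂.W k).baseChange ℂ ⊓ LinearMap.range (f.toLinearMap.baseChange ℂ) := by
  refine le_antisymm (le_inf (f.map_baseChange_W_le k) LinearMap.map_le_range) ?_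
  rintro _ ⟨hyW, x, rfl⟩
  obtain ⟨b, hb⟩ := H₁.exists_W_eq_bot
  obtain ⟨t, ht⟩ := H₁.exists_W_eq_top
  have hxW : x ∈ (H₁.W (b + ((t - b).toNat : ℕ))).baseChange ℂ := by
    have htop : H₁.W (b + ((t - b).toNat : ℕ)) = ⊤ := by
      rcases le_or_gt b t with h | h
      · rw [Int.toNat_of_nonneg (by omega), add_sub_cancel, ht]
      · exact eq_top_iff.2 (ht ▸ H₁.monotone_W (by omega))
    rw [htop, Submodule.baseChange_top]
    trivial
  obtain ⟨x', hx', he⟩ := f.exists_mem_W_apply_eq_aux k b hb _ x hxW hyW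
  exact ⟨x', hx', he⟩

/-- **Morphisms of mixed Hodge structures are strict for the weight filtration**, over `ℚ`:
`f(W_k V) = W_k V' ∩ im f` (Deligne, *Théorie de Hodge II*, Thm. 2.3.5 (iii); Cattani et al.,
Cor. 3.2.21 (i)); from the statement over `ℂ` by faithful flatness of `ℂ/ℚ`.
[cite: DeligneHodgeII1971, Thm. 2.3.5 (iii)] -/
theorem map_W_eq (f : Hom H₁ H₂) (k : ℤ) :
    (H₁.W k).map f.toLinearMap = H₂.W k ⊓ LinearMap.range f.toLinearMap := by
  refine le_antisymm (le_inf (f.map_W_le k) LinearMap.map_le_range) ?_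
  rintro _ ⟨hyW, x, rfl⟩
  refine mem_of_one_tmul_mem_baseChange _ ?_
  rw [← map_baseChange_baseChange, map_baseChange_W_eq]
  refine ⟨Submodule.tmul_mem_baseChange_of_mem 1 hyW, (1 : ℂ) ⊗ₜ x, ?_⟩
  rw [LinearMap.baseChange_tmul]

/-- **Every morphism of mixed Hodge structures is strict** (Deligne, *Théorie de Hodge II*,
Thm. 2.3.5 (iii)). [cite: DeligneHodgeII1971, Thm. 2.3.5 (iii)] -/
theorem isStrict (f : Hom H₁ H₂) : f.IsStrict :=
  ⟨f.map_W_eq, f.map_F_eq⟩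

/-- **Discharge of the named fact `Hom.strict`**: morphisms of mixed `ℚ`-Hodge structures are
strictly compatible with `W` and `F` (Deligne, *Théorie de Hodge II*, Thm. 2.3.5 (iii);
Cattani–El Zein–Griffiths–Lê, *Hodge Theory*, Cor. 3.2.21 (i)), for all ambient spaces `V`, `V'`.
[cite: DeligneHodgeII1971, Thm. 2.3.5 (iii)] -/
theorem strict_holds : Hom.strict (V := V) (V' := V') :=
  fun f => f.isStrict

end Hom

end MixedHodgeStructure

end Literature.AlgebraicGeometry.Motives

end
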